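import Summits.Ventures.HodgeRepro2.T5SU11Horocycle

/-!
# `N` acts simply transitively on each horocycle at `1`

The right-half-plane coordinate `w(z) = (1 + z) / (1 - z)` (`half`) sends the disc onto `{Re w > 0}`
with `1 ↦ ∞`; on the disc its real part is the Poisson kernel at `1` of `T5SU11Horocycle`
(`half_re`), and the unipotent element `n_s` acts on it by the vertical translation
`w ↦ w - 2 i s` (`half_mobius_unip`). Hence the horocycle `H_c = {P = c}` is the vertical line
`{Re w = c}` and `N ≅ ℝ` acts on it simply transitively: for `c > 0` the real point
`x_c = (c - 1)/(c + 1)` lies on `H_c` (`basePoint_mem_horocycle`), every `z ∈ H_c` is `n_s · x_c`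
for exactly one `s` (`existsUnique_mobius_unip_basePoint_eq`), `s ↦ n_s · x_c` is a bijection
`ℝ → H_c` (`mobius_unip_basePoint_bijOn`), and `N` acts freely on the disc
(`eq_zero_of_mobius_unip_eq`). Finally the horocycles are the Euclidean circles internally tangent
to the unit circle at `1`: `H_c = S((c/(1+c)), 1/(1+c)) \ {1}` (`horocycle_eq_sphere_diff`).
Nothing is claimed about (N).

Blind lane: Mathlib + the HodgeRepro2 prefix only; no sorry; axioms ⊆ {propext, Classical.choice,
Quot.sound}.
-/

namespace Summit.Ventures.HodgeRepro2.T5SU11HorocycleTransitive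

open Metric Filter Topology Set Complex
open T5UnitaryBound T5PoincareDensity T5PoincareInvariance T5SU11Unimodular T5SU11Fibration
  T5SU11Cartan T5SU11OneParameter T5BergmanCoefficient T5SU11UnipotentSubgroup T5SU11Horocycle

/-! ### The right-half-plane coordinate `w = (1 + z)/(1 - z)` -/

/-- The right-half-plane coordinate `w(z) = (1 + z) / (1 - z)` (`1 ↦ ∞`, `0 ↦ 1`). -/
noncomputable def half (z : ℂ) : ℂ := (1 + z) / (1 - z)

/-- `1 - z ≠ 0` on the disc. -/
lemma one_sub_ne_zero_of_mem_ball {z : ℂ} (hz : z ∈ ball (0 : ℂ) 1) : 1 - z ≠ 0 := by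
  intro h
  have h1 : z = 1 := by linear_combination -h
  rw [h1, mem_ball_zero_iff] at hz
  simp at hz

/-- `normSq (1 - z) ≠ 0` on the disc. -/
lemma normSq_one_sub_ne_zero {z : ℂ} (hz : z ∈ ball (0 : ℂ) 1) : Complex.normSq (1 - z) ≠ 0 :=
  (Complex.normSq_pos.2 (one_sub_ne_zero_of_mem_ball hz)).ne'

/-- **`Re w(z) = P(z)`**: on the disc the real part of the half-plane coordinate is the Poisson kernel
at `1`. -/
theorem half_re {z : ℂ} (hz : z ∈ ball (0 : ℂ) 1) : (half z).re = poisson z := by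
  have hN := normSq_one_sub_ne_zero hz
  unfold half poisson
  rw [Complex.div_re]
  simp only [Complex.add_re, Complex.one_re, Complex.sub_re, Complex.add_im, Complex.one_im,
    Complex.sub_im, zero_add, zero_sub, Complex.normSq_apply]
  rw [Complex.normSq_apply] at hN
  field_simp
  ring

/-- `w(z) + 1 = 2 / (1 - z)`, hence `w(z) + 1 ≠ 0` on the disc. -/
lemma half_add_one {z : ℂ} (hz : z ∈ ball (0 : ℂ) 1) : half z + 1 = 2 / (1 - z) := by
  have h := one_sub_ne_zero_of_mem_ball hz
  unfold half
  field_simp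
  ring

/-- The inverse coordinate: `z = (w - 1) / (w + 1)`. -/
lemma half_inv {z : ℂ} (hz : z ∈ ball (0 : ℂ) 1) : (half z - 1) / (half z + 1) = z := by
  have h := one_sub_ne_zero_of_mem_ball hz
  unfold half
  field_simp
  ring

/-- `w` is injective on the disc. -/
theorem half_injOn : Set.InjOn half (ball (0 : ℂ) 1) := by
  intro z hz z' hz' h
  rw [← half_inv hz, ← half_inv hz', h]

/-- **`n_s` acts on the half-plane coordinate by the vertical translation `w ↦ w - 2 i s`.** -/
theorem half_mobius_unip (s : ℝ) {z : ℂ} (hz : z ∈ ball (0 : ℂ) 1) :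
    half (mobius (mat (unip s)) z) = half z - 2 * (s : ℂ) * I := by
  have key : half (mobius (mat (unip s)) z) =
      (2 - (1 - mobius (mat (unip s)) z)) / (1 - mobius (mat (unip s)) z) := by
    unfold half
    congr 1
    ring
  rw [key, one_sub_mobius_unip s hz]
  have hD := denom_unip_ne_zero s hz
  have h1 := one_sub_ne_zero_of_mem_ball hz
  unfold half
  generalize hDdef : (s : ℂ) * I * z + (1 - (s : ℂ) * I) = D at hD ⊢
  field_simp
  rw [← hDdef]
  ring

/-- `Im w(n_s · z) = Im w(z) - 2 s`. -/
lemma half_im_mobius_unip (s : ℝ) {z : ℂ} (hz : z ∈ ball (0 : ℂ) 1) :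
    (half (mobius (mat (unip s)) z)).im = (half z).im - 2 * s := by
  rw [half_mobius_unip s hz]
  simp

/-- **`N` acts freely on the disc**: `n_s · z = z` for some `z ∈ 𝔻` forces `s = 0`. -/
theorem eq_zero_of_mobius_unip_eq {s : ℝ} {z : ℂ} (hz : z ∈ ball (0 : ℂ) 1)
    (h : mobius (mat (unip s)) z = z) : s = 0 := by
  have := half_im_mobius_unip s hz
  rw [h] at this
  linarith

/-! ### The Poisson kernel is positive; the base point `x_c` of the horocycle `H_c` -/

/-- `P(z) > 0` on the disc. -/
lemma poisson_pos {z : ℂ} (hz : z ∈ ball (0 : ℂ) 1) : 0 < poisson z := by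
  unfold poisson
  have h1 : 0 < 1 - Complex.normSq z := by
    have := (mem_ball_iff_normSq z).1 hz
    linarith
  exact div_pos h1 (Complex.normSq_pos.2 (one_sub_ne_zero_of_mem_ball hz))

/-- A horocycle of non-positive parameter is empty. -/
lemma horocycle_eq_empty {c : ℝ} (hc : c ≤ 0) : horocycle c = ∅ := by
  ext z
  simp only [horocycle, Set.mem_setOf_eq, Set.mem_empty_iff_false, iff_false, not_and]
  intro hz hP
  have := poisson_pos hz
  linarith

/-- The base point `x_c = (c - 1) / (c + 1)` of the horocycle `H_c` (real, on the diameter through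
`1`). -/
noncomputable def basePoint (c : ℝ) : ℂ := ((c - 1) / (c + 1) : ℝ)

/-- `x_c ∈ 𝔻` for `c > 0`. -/
lemma basePoint_mem_ball {c : ℝ} (hc : 0 < c) : basePoint c ∈ ball (0 : ℂ) 1 := by
  rw [basePoint, mem_ball_zero_iff, Complex.norm_real, Real.norm_eq_abs, abs_lt]
  constructor
  · rw [lt_div_iff₀ (by linarith)]
    linarith
  · rw [div_lt_iff₀ (by linarith)]
    linarith

/-- `w(x_c) = c`. -/
lemma half_basePoint {c : ℝ} (hc : 0 < c) : half (basePoint c) = c := by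
  have h1 : (c : ℂ) + 1 ≠ 0 := by
    intro h
    have := congrArg Complex.re h
    simp at this
    linarith
  have hne : (1 : ℂ) - (((c - 1) / (c + 1) : ℝ) : ℂ) ≠ 0 :=
    one_sub_ne_zero_of_mem_ball (basePoint_mem_ball hc)
  unfold half basePoint
  rw [div_eq_iff hne]
  push_cast
  field_simp
  ring

/-- `P(x_c) = c`. -/
lemma poisson_basePoint {c : ℝ} (hc : 0 < c) : poisson (basePoint c) = c := by
  rw [← half_re (basePoint_mem_ball hc), half_basePoint hc, Complex.ofReal_re]

/-- **`x_c` lies on the horocycle `H_c`.** -/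
theorem basePoint_mem_horocycle {c : ℝ} (hc : 0 < c) : basePoint c ∈ horocycle c :=
  ⟨basePoint_mem_ball hc, poisson_basePoint hc⟩

/-! ### Simple transitivity of `N` on `H_c` -/

/-- On `H_c` the half-plane coordinate is `w = c + i · Im w`. -/
lemma half_eq_of_mem_horocycle {c : ℝ} {z : ℂ} (hz : z ∈ horocycle c) :
    half z = (c : ℂ) + ((half z).im : ℂ) * I := by
  have h := Complex.re_add_im (half z)
  rw [half_re hz.1, hz.2] at h
  exact h.symm

/-- `n_s · x_c` has half-plane coordinate `c - 2 i s`. -/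
lemma half_mobius_unip_basePoint {c : ℝ} (hc : 0 < c) (s : ℝ) :
    half (mobius (mat (unip s)) (basePoint c)) = (c : ℂ) - 2 * (s : ℂ) * I := by
  rw [half_mobius_unip s (basePoint_mem_ball hc), half_basePoint hc]

/-- `n_s · x_c ∈ H_c`. -/
lemma mobius_unip_basePoint_mem_horocycle {c : ℝ} (hc : 0 < c) (s : ℝ) :
    mobius (mat (unip s)) (basePoint c) ∈ horocycle c :=
  horocycle_mobius_unip s (basePoint_mem_horocycle hc)

/-- **`N` acts transitively on `H_c`**: every `z ∈ H_c` is `n_s · x_c` for `s = -Im w(z)/2`. -/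
theorem mobius_unip_basePoint_eq {c : ℝ} (hc : 0 < c) {z : ℂ} (hz : z ∈ horocycle c) :
    mobius (mat (unip (-(half z).im / 2))) (basePoint c) = z := by
  apply half_injOn (mobius_unip_basePoint_mem_horocycle hc _).1 hz.1
  rw [half_mobius_unip_basePoint hc]
  conv_rhs => rw [half_eq_of_mem_horocycle hz]
  push_cast
  ring

/-- **The stabiliser of `x_c` in `N` is trivial**, and `n_s · x_c` determines `s`. -/
theorem mobius_unip_basePoint_injective {c : ℝ} (hc : 0 < c) {s s' : ℝ}
    (h : mobius (mat (unip s)) (basePoint c) = mobius (mat (unip s')) (basePoint c)) : s = s' := by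
  have := congrArg (fun w => (half w).im) h
  simp only [half_mobius_unip_basePoint hc] at this
  simp at this
  linarith

/-- **`N` acts simply transitively on the horocycle `H_c`**: for every `z ∈ H_c` there is exactly
one `s ∈ ℝ` with `n_s · x_c = z`. -/
theorem existsUnique_mobius_unip_basePoint_eq {c : ℝ} (hc : 0 < c) {z : ℂ} (hz : z ∈ horocycle c) :
    ∃! s : ℝ, mobius (mat (unip s)) (basePoint c) = z := by
  refine ⟨-(half z).im / 2, mobius_unip_basePoint_eq hc hz, fun s hs => ?_⟩
  exact mobius_unip_basePoint_injective hc (hs.trans (mobius_unip_basePoint_eq hc hz).symm)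

/-- **`s ↦ n_s · x_c` is a bijection `ℝ → H_c`.** -/
theorem mobius_unip_basePoint_bijOn {c : ℝ} (hc : 0 < c) :
    Set.BijOn (fun s : ℝ => mobius (mat (unip s)) (basePoint c)) Set.univ (horocycle c) := by
  refine ⟨fun s _ => mobius_unip_basePoint_mem_horocycle hc s, ?_, ?_⟩
  · intro s _ s' _ h
    exact mobius_unip_basePoint_injective hc h
  · intro z hz
    exact ⟨-(half z).im / 2, Set.mem_univ _, mobius_unip_basePoint_eq hc hz⟩

/-- **The horocycle `H_c` is the `N`-orbit of `x_c`.** -/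
theorem horocycle_eq_range {c : ℝ} (hc : 0 < c) :
    horocycle c = Set.range fun s : ℝ => mobius (mat (unip s)) (basePoint c) := by
  ext z
  constructor
  · intro hz
    exact ⟨-(half z).im / 2, mobius_unip_basePoint_eq hc hz⟩
  · rintro ⟨s, rfl⟩
    exact mobius_unip_basePoint_mem_horocycle hc s

/-! ### The horocycles are the circles internally tangent to the unit circle at `1` -/

/-- `P(z) = c` on the disc iff `1 - |z|² = c |1 - z|²`. -/
lemma poisson_eq_iff {c : ℝ} {z : ℂ} (hz : z ∈ ball (0 : ℂ) 1) :
    poisson z = c ↔ 1 - Complex.normSq z = c * Complex.normSq (1 - z) := by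
  unfold poisson
  rw [div_eq_iff (normSq_one_sub_ne_zero hz)]

/-- **The horocycle `H_c` (`c > 0`) is the Euclidean circle of centre `c/(1+c)` and radius
`1/(1+c)`, internally tangent to the unit circle at `1`, with the point `1` removed.** -/
theorem horocycle_eq_sphere_diff {c : ℝ} (hc : 0 < c) :
    horocycle c = sphere ((c / (1 + c) : ℝ) : ℂ) (1 / (1 + c)) \ {1} := by
  have hc1 : (1 + c) ≠ 0 := by linarith
  ext z
  simp only [horocycle, Set.mem_setOf_eq, Set.mem_sdiff, mem_sphere_iff_norm,
    Set.mem_singleton_iff]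
  -- `‖z - a‖ = r ↔ normSq (z - a) = r²` for `r ≥ 0`
  have hsph : ‖z - ((c / (1 + c) : ℝ) : ℂ)‖ = 1 / (1 + c) ↔
      Complex.normSq (z - ((c / (1 + c) : ℝ) : ℂ)) = (1 / (1 + c)) ^ 2 := by
    rw [Complex.normSq_eq_norm_sq]
    constructor
    · intro h; rw [h]
    · intro h
      have hr : 0 ≤ 1 / (1 + c) := by positivity
      exact (pow_left_inj₀ (norm_nonneg _) hr two_ne_zero).1 h
  rw [hsph]
  -- expand both quadratic conditions in `x = Re z`, `y = Im z`
  have e1 : Complex.normSq (z - ((c / (1 + c) : ℝ) : ℂ)) =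
      Complex.normSq z - 2 * (c / (1 + c)) * z.re + (c / (1 + c)) ^ 2 := by
    simp only [Complex.normSq_apply, Complex.sub_re, Complex.ofReal_re, Complex.sub_im,
      Complex.ofReal_im, sub_zero]
    ring
  have e2 : Complex.normSq (1 - z) = 1 - 2 * z.re + Complex.normSq z := by
    simp only [Complex.normSq_apply, Complex.sub_re, Complex.one_re, Complex.sub_im,
      Complex.one_im, zero_sub]
    ring
  constructor
  · rintro ⟨hz, hP⟩
    rw [poisson_eq_iff hz, e2] at hP
    refine ⟨?_, ?_⟩
    · rw [e1]
      field_simp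
      linear_combination (-(1 + c)) * hP
    · intro h1
      rw [h1] at hz
      rw [mem_ball_zero_iff] at hz
      simp at hz
  · rintro ⟨hs, h1⟩
    rw [e1] at hs
    have hP : 1 - Complex.normSq z = c * Complex.normSq (1 - z) := by
      rw [e2]
      field_simp at hs
      apply mul_left_cancel₀ hc1
      linear_combination (-1 : ℝ) * hs
    have hz1 : 1 - z ≠ 0 := by
      intro h
      apply h1
      linear_combination -h
    have hpos : 0 < Complex.normSq (1 - z) := Complex.normSq_pos.2 hz1
    have hz : z ∈ ball (0 : ℂ) 1 := by
      rw [mem_ball_iff_normSq]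
      nlinarith [mul_pos hc hpos]
    exact ⟨hz, (poisson_eq_iff hz).2 hP⟩

end Summit.Ventures.HodgeRepro2.T5SU11HorocycleTransitive
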